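import Summits.HodgeConjecture.HodgeConjecture.Theorems.Ring2WeilCoverageCyclotomicUnitSignaturesFamily
import HarnessLib

/-!
# Weil-type family coverage — the TWISTED unit supply: when the real units' sign vectors only fill the patterns
# with EVEN weight on EACH of two classes of places, same-class pair witnesses of a unit family still give every
# such pattern, and the census's YES verdicts at the index-2 levels follow

research route conditional on HC_CM; not a corollary; Q11.4-sentence-2 already refuted in dim ≥ 3.

Ring 2, WEIL-TYPE FAMILY-COVERAGE CENSUS (`HOME/WEIL-FAMILY-COVERAGE.md` `## b01`, block b01.25 (A): «at `M = 39, 56`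
the annihilator of the unit sign matrix is `{0, parity, λ, λ + parity}`, `λ = Σ_{χ′(t) = +1}` … `A_Φ` principal ⟺
`n₊₋(Φ)` ODD (39; 56 with `K = ℚ(i), ℚ(√−2)`) resp. EVEN»; owner ring2-b01), part 38 of the `Ring2WeilCoverage*`
series — the YES-direction counterpart of parts 33/35 (twisted obstruction), built on part 21
(`…CyclotomicUnitSignaturesFamily`: an ABSTRACT family of real units of `ℚ(ζₙ)` indexed by `α` with decidable sign
law `σ x t`, admissibility `adm`, and the FAMILY PROPERTY «admissible signed products `(A, ε)` are units of `𝓞 K`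
fixed by `ρ` with `Re φ_t(u) < 0 ↔ patF A ε t`»).  At the index-2 levels the witness property `(W)` of parts 14/21
FAILS (not every pair `{±1, ±s}` is a pattern); what holds is its restriction to pairs INSIDE a class.  For a
finite set `C ⊂ ℤ/n` (one class; the other is its complement in the units):

* §1 (combinatorics) `exists_pattern_of_pairs_on`: if every two unit residues `t₁, t₂` of the SAME class
  (`t₁ ∈ C ↔ t₂ ∈ C`), `t₂ ≠ ±t₁`, admit an admissible signed product with pattern `{±t₁, ±t₂}` (hypothesis `hpair`)
  and `C` is symmetric (`−t ∈ C ↔ t ∈ C`), then for every CM type set `T` and every `J ⊆ T` with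
  `|J ∩ C|` and `|J ∖ C|` BOTH EVEN some `(A, ε)` has pattern `{t : t ∈ J ∨ −t ∈ J}` (peel a same-class pair);
  `pairs_on_of_base`: `hpair` for a class from witnesses `{±b, ±s}` off ONE base point `b` of the class.
* §2 (the number field) `exists_units_sign_eq_on`: FAMILY PROPERTY + `hpair` ⇒ for every CM type `Φ` and `S ⊆ Φ`
  whose residue set `J = {t : ∃ σ ∈ S, σ ζ = 𝐞(t)}` has `|J ∩ C|`, `|J ∖ C|` even, a unit `u` of `𝓞 K` fixed by
  `ρ` has `Re φ(u) < 0 ↔ φ ∈ S` on `Φ`; `exists_pos_isOfType_of_units_sign` (abstract CM field, part 2's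
  setting): a real unit with the sign pattern of the skew `ζ₀` of type `𝔣₀` gives a `Φ`-positive divisor of type
  `𝔣₀`; and **`exists_principal_of_pairs_on`**: for `K = ℚ(ζₙ)` CM, `φ(n) = 2(k+1)`, a unit family with `hpair` on
  `C`, and a CM type `Φ` whose residues at odd position split EVENLY on both classes —
  `|S_Φ ∩ N_odd ∩ C|` and `|(S_Φ ∩ N_odd) ∖ C|` even — the principal CM torus `ℂ^Φ/Φ(ℤ[ζₙ])` CARRIES an
  `ι`-compatible principal polarisation (`∃ ζ′`, `ζ′^ρ = −ζ′`, `Im φ(ζ′) > 0` on `Φ`, `IsOfType 1 ζ′ ⊤`).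

HONEST FRAMING: `hpair` and the family property are HYPOTHESES here (discharged per level by `decide`d witness
tables and parts 13/20); statements about Shimura's divisors of principal type on `ℂ^Φ/Φ(ℤ[ζₙ])`; nothing about
Hodge classes, `W_K`, general members or HC; `HC_CM` is used nowhere.  No `def`, no named fact, no `sorry`.

References: [cite: Shimura1998, §14.3 Prop. 4–5, pp. 103–104]; [cite: Washington1997, §8.1]; census b01.25 (A)
(seat-derived).
-/

noncomputable section

open Polynomial NumberField Complex Finset
open scoped Real nonZeroDivisors symmDiff

namespace Summit.HodgeConjecture.Ring2WeilCoverage.TwistedUnitWitnesses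

open Literature.AlgebraicGeometry.Motives (CMType)
open Literature.AlgebraicGeometry.HodgeTheory (IsCMTypeSet)
open Literature.AlgebraicGeometry.ComplexMultiplication.CyclotomicCMType
  (exists_apply_eq_toCircle embedding_eq_of_apply_eq isCMTypeSet_residueFilter)
open Literature.NumberTheory.ComplexMultiplication
open Summit.HodgeConjecture.Ring2WeilCoverage.CyclotomicUnitSignaturesFamily (patF_symmDiff admF_symmDiff)
open Summit.HodgeConjecture.Ring2WeilCoverage.CMUnitSignature
open Summit.HodgeConjecture.Ring2WeilCoverage.CMTypeSignParity
open Summit.HodgeConjecture.Ring2WeilCoverage.CyclotomicDifferent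
open Summit.HodgeConjecture.Ring2WeilCoverage.CyclotomicPrincipalObstruction

variable {n : ℕ} [NeZero n] {α : Type} [DecidableEq α] (σ : α → ZMod n → Prop) [∀ x t, Decidable (σ x t)]
  (adm : α → Prop) (C : Finset (ZMod n))

/-- `𝐞(t) = exp(2πi t/n) ∈ ℂ` (`ZMod.toCircle`). -/
local notation3 (prettyPrint := false) "𝐞 " t:max => ((ZMod.toCircle t : Circle) : ℂ)

/-- the sign pattern of the signed product `(A, ε)` at `t` for the sign law `σ` (part 21). -/
local notation3 (prettyPrint := false) "patF " A:max ε:max t:max =>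
  Odd ((Finset.filter (fun x => σ x t) A).card + (if (ε : Bool) then 1 else 0))

/-- the SAME-CLASS PAIR PROPERTY of the level for the family (`σ`, `adm`) and the class `C`. -/
local notation3 (prettyPrint := false) "PairPropertyOn" =>
  (∀ t₁ t₂ : ZMod n, t₁.val.Coprime n → t₂.val.Coprime n → (t₁ ∈ C ↔ t₂ ∈ C) → t₂ ≠ t₁ → t₂ ≠ -t₁ →
    ∃ A : Finset α, ∃ ε : Bool, (∀ x ∈ A, adm x) ∧
      ∀ t : ZMod n, t.val.Coprime n → (patF A ε t ↔ (t = t₁ ∨ t = -t₁ ∨ t = t₂ ∨ t = -t₂)))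

/-- `below t` and `N_odd` as in parts 5–7. -/
local notation3 (prettyPrint := false) "Nodd" =>
  (Finset.univ.filter fun t : ZMod n => t.val.Coprime n ∧
    Even (Finset.card (Finset.filter (fun s : ZMod n => s.val.Coprime n ∧ s.val < t.val) Finset.univ)))

/-! ### §1 Same-class pairs give every pattern with even weight on both classes -/

omit [NeZero n] in
/-- **Pairs of a class from ONE base point**: if `b` is a unit residue and every unit residue `s` of the class of
`b` (`s ∈ C ↔ b ∈ C`) with `s ≠ ±b` has a witness with pattern `{±b, ±s}`, then every two unit residues `t₁, t₂` of
that class with `t₂ ≠ ±t₁` have a witness with pattern `{±t₁, ±t₂}` (the symmetric difference of the two base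
witnesses when neither is `±b`).
research route conditional on HC_CM; not a corollary; Q11.4-sentence-2 already refuted in dim ≥ 3. [folklore] -/
theorem pairs_on_of_base {b : ZMod n} (hC : ∀ t : ZMod n, t.val.Coprime n → (-t ∈ C ↔ t ∈ C))
    (hbase : ∀ s : ZMod n, s.val.Coprime n → (s ∈ C ↔ b ∈ C) → s ≠ b → s ≠ -b →
      ∃ A : Finset α, ∃ ε : Bool, (∀ x ∈ A, adm x) ∧
        ∀ t : ZMod n, t.val.Coprime n → (patF A ε t ↔ (t = b ∨ t = -b ∨ t = s ∨ t = -s)))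
    {t₁ t₂ : ZMod n} (h₁ : t₁.val.Coprime n) (h₂ : t₂.val.Coprime n) (hc₁ : t₁ ∈ C ↔ b ∈ C)
    (hc₂ : t₂ ∈ C ↔ b ∈ C) (hne : t₂ ≠ t₁) (hne' : t₂ ≠ -t₁) :
    ∃ A : Finset α, ∃ ε : Bool, (∀ x ∈ A, adm x) ∧
      ∀ t : ZMod n, t.val.Coprime n → (patF A ε t ↔ (t = t₁ ∨ t = -t₁ ∨ t = t₂ ∨ t = -t₂)) := by
  have _ := hC
  have hne'' : t₁ ≠ -t₂ := fun h => hne' (by rw [h, neg_neg])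
  by_cases h1 : t₁ = b ∨ t₁ = -b
  · have h2a : t₂ ≠ b := by
      rcases h1 with rfl | rfl
      · exact hne
      · rwa [neg_neg] at hne'
    have h2b : t₂ ≠ -b := by
      rcases h1 with rfl | rfl
      · exact hne'
      · exact hne
    obtain ⟨A, ε, hA, hP⟩ := hbase t₂ h₂ hc₂ h2a h2b
    refine ⟨A, ε, hA, fun t ht => ?_⟩
    rw [hP t ht]
    rcases h1 with rfl | rfl
    · exact Iff.rfl
    · rw [neg_neg]; tauto
  · push Not at h1
    by_cases h2 : t₂ = b ∨ t₂ = -b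
    · obtain ⟨A, ε, hA, hP⟩ := hbase t₁ h₁ hc₁ h1.1 h1.2
      refine ⟨A, ε, hA, fun t ht => ?_⟩
      rw [hP t ht]
      rcases h2 with rfl | rfl
      · tauto
      · rw [neg_neg]; tauto
    · push Not at h2
      obtain ⟨A₁, ε₁, hA₁, hP₁⟩ := hbase t₁ h₁ hc₁ h1.1 h1.2
      obtain ⟨A₂, ε₂, hA₂, hP₂⟩ := hbase t₂ h₂ hc₂ h2.1 h2.2
      refine ⟨A₁ ∆ A₂, xor ε₁ ε₂, admF_symmDiff adm hA₁ hA₂, fun t ht => ?_⟩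
      rw [patF_symmDiff σ, hP₁ t ht, hP₂ t ht]
      obtain ⟨h11, h12⟩ := h1
      obtain ⟨h21, h22⟩ := h2
      have e1 : -t₁ ≠ b := fun h => h12 (by rw [← h, neg_neg])
      have e2 : -t₁ ≠ -b := fun h => h11 (neg_injective h)
      have e3 : -t₂ ≠ b := fun h => h22 (by rw [← h, neg_neg])
      have e4 : -t₂ ≠ -b := fun h => h21 (neg_injective h)
      have e5 : -t₁ ≠ t₂ := fun h => hne' h.symm
      have e6 : -t₁ ≠ -t₂ := fun h => hne (neg_injective h).symm
      constructor
      · rintro (⟨ha, hb⟩ | ⟨ha, hb⟩) <;> tauto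
      · rintro (rfl | rfl | rfl | rfl)
        · left
          exact ⟨by tauto, fun h => by rcases h with h | h | h | h; exacts [h11 h, h12 h, hne h.symm, hne'' h]⟩
        · left
          exact ⟨by tauto, fun h => by rcases h with h | h | h | h; exacts [e1 h, e2 h, e5 h, e6 h]⟩
        · right
          exact ⟨by tauto, fun h => by rcases h with h | h | h | h; exacts [h21 h, h22 h, hne h, hne' h]⟩
        · right
          exact ⟨by tauto, fun h => by
            rcases h with h | h | h | h
            exacts [e3 h, e4 h, hne'' h.symm, hne (neg_injective h)]⟩

/-- **PATTERNS WITH EVEN WEIGHT ON BOTH CLASSES ARE PATTERNS**: under the same-class pair property for a symmetric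
class `C`, for every CM type set `T` and every `J ⊆ T` with `|J ∩ C|` and `|J ∖ C|` both even there is an
admissible signed product `(A, ε)` with `patF A ε t ↔ (t ∈ J ∨ −t ∈ J)` for all unit residues `t`.  Induction on
`|J|`: peel a pair `t₁, t₂ ∈ J` of the SAME class (the class of any `t₁ ∈ J` meets `J` in an even, non-zero number
of residues); the pieces are disjoint because `T` contains no opposite pair.
research route conditional on HC_CM; not a corollary; Q11.4-sentence-2 already refuted in dim ≥ 3. [folklore] -/
theorem exists_pattern_of_pairs_on (hpair : PairPropertyOn) (hC : ∀ t : ZMod n, t.val.Coprime n → (-t ∈ C ↔ t ∈ C))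
    {T : Finset (ZMod n)} (hT : IsCMTypeSet n T) (J : Finset (ZMod n)) (hJT : J ⊆ T)
    (hJC : Even (J.filter fun t => t ∈ C).card) (hJC' : Even (J.filter fun t => t ∉ C).card) :
    ∃ A : Finset α, ∃ ε : Bool, (∀ x ∈ A, adm x) ∧
      ∀ t : ZMod n, t.val.Coprime n → (patF A ε t ↔ (t ∈ J ∨ -t ∈ J)) := by
  classical
  have _ := hC
  suffices hk : ∀ k : ℕ, ∀ J : Finset (ZMod n), J.card = k → J ⊆ T → Even (J.filter fun t => t ∈ C).card →
      Even (J.filter fun t => t ∉ C).card →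
      ∃ A : Finset α, ∃ ε : Bool, (∀ x ∈ A, adm x) ∧
        ∀ t : ZMod n, t.val.Coprime n → (patF A ε t ↔ (t ∈ J ∨ -t ∈ J)) from hk _ J rfl hJT hJC hJC'
  intro k
  induction k using Nat.strong_induction_on with
  | _ k ih =>
    intro J hJk hJT hJC hJC'
    by_cases hJ0 : J = ∅
    · refine ⟨∅, false, fun x hx => absurd hx (Finset.notMem_empty x), fun t _ => ?_⟩
      subst hJ0
      simp
    · -- peel a same-class pair
      obtain ⟨t₁, ht₁⟩ := Finset.nonempty_of_ne_empty hJ0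
      -- a second element `t₂ ∈ J` of the class of `t₁` (that class meets `J` in an even, non-zero number)
      have hex : ∃ t₂ ∈ J, t₂ ≠ t₁ ∧ (t₂ ∈ C ↔ t₁ ∈ C) := by
        set J₁ := J.filter fun t => (t ∈ C ↔ t₁ ∈ C) with hJ₁
        have hJ₁even : Even J₁.card := by
          by_cases hc : t₁ ∈ C
          · have : J₁ = J.filter fun t => t ∈ C := by
              rw [hJ₁]; exact Finset.filter_congr fun t _ => by simp [hc]
            rw [this]; exact hJC
          · have : J₁ = J.filter fun t => t ∉ C := by
              rw [hJ₁]; exact Finset.filter_congr fun t _ => by simp [hc]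
            rw [this]; exact hJC'
        have ht₁J₁ : t₁ ∈ J₁ := Finset.mem_filter.mpr ⟨ht₁, Iff.rfl⟩
        have hJ₁2 : 2 ≤ J₁.card := by
          obtain ⟨j, hj⟩ := hJ₁even
          have : 0 < J₁.card := Finset.card_pos.mpr ⟨t₁, ht₁J₁⟩
          omega
        have hJ₁ne : (J₁.erase t₁).Nonempty :=
          Finset.card_pos.mp (by rw [Finset.card_erase_of_mem ht₁J₁]; omega)
        obtain ⟨t₂, ht₂⟩ := hJ₁ne
        obtain ⟨ht₂₁, ht₂J₁⟩ := Finset.mem_erase.mp ht₂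
        obtain ⟨ht₂J, hct₂⟩ := Finset.mem_filter.mp ht₂J₁
        exact ⟨t₂, ht₂J, ht₂₁, hct₂⟩
      obtain ⟨t₂, ht₂J, ht₂₁, hct₂⟩ := hex
      set J' := (J.erase t₁).erase t₂ with hJ'
      have ht₂e : t₂ ∈ J.erase t₁ := Finset.mem_erase.mpr ⟨ht₂₁, ht₂J⟩
      have hJ'card : J'.card = k - 2 := by
        have e1 := Finset.card_erase_of_mem ht₂e
        have e2 := Finset.card_erase_of_mem ht₁
        rw [hJ']; omega
      have hk2 : 2 ≤ k := by
        have e1 := Finset.card_erase_of_mem ht₂e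
        have e2 := Finset.card_erase_of_mem ht₁
        have e3 : 0 < ((J.erase t₁).erase t₂).card + 1 := Nat.succ_pos _
        have e4 : 0 < (J.erase t₁).card := Finset.card_pos.mpr ⟨t₂, ht₂e⟩
        omega
      have hJ'T : J' ⊆ T := fun t ht => hJT (Finset.mem_of_mem_erase (Finset.mem_of_mem_erase ht))
      -- membership bookkeeping
      have m1 : t₁ ∉ J' := by rw [hJ']; simp
      have m2 : t₂ ∉ J' := by rw [hJ']; simp
      have hmem : ∀ s : ZMod n, s ∈ J ↔ (s ∈ J' ∨ s = t₁ ∨ s = t₂) := fun s => by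
        rw [hJ', Finset.mem_erase, Finset.mem_erase]
        constructor
        · intro hs
          by_cases e1 : s = t₁
          · exact Or.inr (Or.inl e1)
          · by_cases e2 : s = t₂
            · exact Or.inr (Or.inr e2)
            · exact Or.inl ⟨e2, e1, hs⟩
        · rintro (⟨-, -, hs⟩ | rfl | rfl)
          exacts [hs, ht₁, ht₂J]
      -- the two class counts of `J'`: both `t₁, t₂` lie in the same class
      have hfe : ∀ (p : ZMod n → Prop) [DecidablePred p], J'.filter p = ((J.filter p).erase t₁).erase t₂ := by
        intro p _
        rw [hJ', Finset.filter_erase, Finset.filter_erase]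
      have hdrop : ∀ (p : ZMod n → Prop) [DecidablePred p], (p t₁ ↔ p t₂) → Even (J.filter p).card →
          Even (J'.filter p).card := by
        intro p _ hp hev
        rw [hfe p]
        by_cases hp1 : p t₁
        · have m₁ : t₁ ∈ J.filter p := Finset.mem_filter.mpr ⟨ht₁, hp1⟩
          have m₂ : t₂ ∈ (J.filter p).erase t₁ :=
            Finset.mem_erase.mpr ⟨ht₂₁, Finset.mem_filter.mpr ⟨ht₂J, hp.mp hp1⟩⟩
          have c₁ := Finset.card_erase_of_mem m₁
          have c₂ := Finset.card_erase_of_mem m₂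
          have cpos : 0 < ((J.filter p).erase t₁).card := Finset.card_pos.mpr ⟨t₂, m₂⟩
          obtain ⟨j, hj⟩ := hev
          exact ⟨j - 1, by omega⟩
        · have hp2 : ¬ p t₂ := fun h => hp1 (hp.mpr h)
          have m₁ : t₁ ∉ J.filter p := fun h => hp1 (Finset.mem_filter.mp h).2
          rw [Finset.erase_eq_of_notMem m₁]
          have m₂ : t₂ ∉ J.filter p := fun h => hp2 (Finset.mem_filter.mp h).2
          rw [Finset.erase_eq_of_notMem m₂]
          exact hev
      have hJ'C : Even (J'.filter fun t => t ∈ C).card := hdrop (fun t => t ∈ C) hct₂.symm hJC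
      have hJ'C' : Even (J'.filter fun t => t ∉ C).card := hdrop (fun t => t ∉ C) (not_congr hct₂.symm) hJC'
      obtain ⟨A', ε', hA', hP'⟩ := ih (k - 2) (by omega) J' hJ'card hJ'T hJ'C hJ'C'
      have hu₁ : t₁.val.Coprime n := hT.1 t₁ (hJT ht₁)
      have hu₂ : t₂.val.Coprime n := hT.1 t₂ (hJT ht₂J)
      have hnT₁ : -t₁ ∉ T := (hT.2 t₁ hu₁).mp (hJT ht₁)
      have hnT₂ : -t₂ ∉ T := (hT.2 t₂ hu₂).mp (hJT ht₂J)
      have hne' : t₂ ≠ -t₁ := fun h => hnT₁ (h ▸ hJT ht₂J)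
      obtain ⟨A₂, ε₂, hA₂, hP₂⟩ := hpair t₁ t₂ hu₁ hu₂ hct₂.symm ht₂₁ hne'
      refine ⟨A' ∆ A₂, xor ε' ε₂, admF_symmDiff adm hA' hA₂, fun t ht => ?_⟩
      rw [patF_symmDiff σ, hP' t ht, hP₂ t ht]
      have m3 : -t₁ ∉ J' := fun h => hnT₁ (hJ'T h)
      have m4 : -t₂ ∉ J' := fun h => hnT₂ (hJ'T h)
      have hdis : (t ∈ J' ∨ -t ∈ J') → ¬ (t = t₁ ∨ t = -t₁ ∨ t = t₂ ∨ t = -t₂) := by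
        rintro (hX | hX) hP
        · rcases hP with rfl | rfl | rfl | rfl
          exacts [m1 hX, m3 hX, m2 hX, m4 hX]
        · rcases hP with rfl | rfl | rfl | rfl
          · exact m3 hX
          · rw [neg_neg] at hX; exact m1 hX
          · exact m4 hX
          · rw [neg_neg] at hX; exact m2 hX
      have hY : (t ∈ J ∨ -t ∈ J) ↔ ((t ∈ J' ∨ -t ∈ J') ∨ (t = t₁ ∨ t = -t₁ ∨ t = t₂ ∨ t = -t₂)) := by
        clear hfe hdrop hP' hP₂ hA' hA₂ ih hpair hJ'C hJ'C' hJC hJC' hdis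
        rw [hmem t, hmem (-t), neg_eq_iff_eq_neg (a := t) (b := t₁), neg_eq_iff_eq_neg (a := t) (b := t₂)]
        tauto
      rw [hY]
      constructor
      · rintro (⟨hX, -⟩ | ⟨hP, -⟩)
        exacts [Or.inl hX, Or.inr hP]
      · rintro (hX | hP)
        · exact Or.inl ⟨hX, hdis hX⟩
        · by_cases hX : t ∈ J' ∨ -t ∈ J'
          · exact Or.inl ⟨hX, hdis hX⟩
          · exact Or.inr ⟨hP, hX⟩

/-! ### §2 The number field: real units with any sign pattern of even weight on both classes; the YES verdict -/

variable {K : Type} [Field K] [NumberField K] {ζ : K}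

/-- the FAMILY PROPERTY of part 21: admissible signed products are real units of `𝓞 K` with the sign law `σ`. -/
local notation3 (prettyPrint := false) "FamilyProperty" =>
  (∀ A : Finset α, (∀ x ∈ A, adm x) → ∀ ε : Bool,
    ∃ u : (𝓞 K)ˣ, IsCMField.complexConj K ((u : 𝓞 K) : K) = ((u : 𝓞 K) : K) ∧
      ∀ (φ : K →+* ℂ) (t : ZMod n), φ ζ = 𝐞 t → t.val.Coprime n →
        (((φ ((u : 𝓞 K) : K)).re < 0) ↔ patF A ε t))

open scoped Classical in
/-- **TWISTED THEOREM L (ii): every sign pattern with EVEN weight on BOTH classes is a real unit's.**  For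
`K = ℚ(ζₙ)` a CM field, a unit family with the family property and the same-class pair property on a symmetric
class `C`, every CM type `Φ` and every `S ⊆ Φ` whose residue set `J_S = {t : ∃ σ ∈ S, σ ζ = 𝐞(t)}` has
`|J_S ∩ C|` and `|J_S ∖ C|` even admit a unit `u` of `𝓞 K` fixed by `ρ` with `Re φ(u) < 0 ↔ φ ∈ S` on `Φ`.
research route conditional on HC_CM; not a corollary; Q11.4-sentence-2 already refuted in dim ≥ 3. [cite: Washington1997, §8.1] -/
theorem exists_units_sign_eq_on [IsCMField K] [IsCyclotomicExtension {n} ℚ K] (hζ : IsPrimitiveRoot ζ n)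
    (hfam : FamilyProperty) (hpair : PairPropertyOn) (hC : ∀ t : ZMod n, t.val.Coprime n → (-t ∈ C ↔ t ∈ C))
    (Φ : CMType K) (S : Set (K →+* ℂ)) (hS : S ⊆ Φ.1) (J : Finset (ZMod n))
    (hJ : ∀ t : ZMod n, t ∈ J ↔ ∃ σ ∈ S, σ ζ = 𝐞 t)
    (hevC : Even (J.filter fun t => t ∈ C).card) (hevC' : Even (J.filter fun t => t ∉ C).card) :
    ∃ u : (𝓞 K)ˣ, IsCMField.complexConj K ((u : 𝓞 K) : K) = ((u : 𝓞 K) : K) ∧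
      ∀ φ ∈ Φ.1, ((φ ((u : 𝓞 K) : K)).re < 0 ↔ φ ∈ S) := by
  classical
  set T := Finset.univ.filter fun t : ZMod n => ∃ σ ∈ Φ.1, σ ζ = 𝐞 t with hTdef
  have hT : IsCMTypeSet n T := isCMTypeSet_residueFilter hζ Φ
  have hJT : J ⊆ T := fun t ht => by
    obtain ⟨σ, hσ, hσt⟩ := (hJ t).mp ht
    exact Finset.mem_filter.mpr ⟨Finset.mem_univ _, σ, hS hσ, hσt⟩
  obtain ⟨A, ε, hA, hP⟩ := exists_pattern_of_pairs_on σ adm C hpair hC hT J hJT hevC hevC'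
  obtain ⟨u, hconj, hsign⟩ := hfam A hA ε
  refine ⟨u, hconj, fun φ hφ => ?_⟩
  obtain ⟨t, ht, hφt⟩ := exists_apply_eq_toCircle hζ φ
  rw [hsign φ t hφt ht, hP t ht]
  have htT : t ∈ T := Finset.mem_filter.mpr ⟨Finset.mem_univ _, φ, hφ, hφt⟩
  have hnt : -t ∉ T := (hT.2 t ht).mp htT
  constructor
  · rintro (h | h)
    · obtain ⟨σ, hσS, hσt⟩ := (hJ t).mp h
      rwa [embedding_eq_of_apply_eq hζ (hφt.trans hσt.symm)]
    · exact absurd (hJT h) hnt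
  · intro h
    exact Or.inl ((hJ t).mpr ⟨φ, h, hφt⟩)

/-- **A real unit with the sign pattern of `ζ₀` gives a `Φ`-positive divisor of type `𝔣₀`** (part 2's setting, any
CM field `K`): if `ζ₀ ≠ 0` is skew of type `𝔣₀` on `D(𝔪)` and a unit `u` of `𝓞 K` fixed by `ρ` has
`Re φ(u) < 0 ↔ Im φ(ζ₀) < 0` for every `φ ∈ Φ`, then `ζ = uζ₀` is a `Φ`-positive skew element of type `𝔣₀`.
research route conditional on HC_CM; not a corollary; Q11.4-sentence-2 already refuted in dim ≥ 3. [cite: Shimura1998, §14.3 Prop. 5, p. 104] -/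
theorem exists_pos_isOfType_of_units_sign {K : Type} [Field K] [NumberField K] [IsCMField K] (Φ : CMType K)
    (𝔪 : (FractionalIdeal (𝓞 K)⁰ K)ˣ) {ζ₀ : K} {𝔣₀ : Ideal (𝓞 (maximalRealSubfield K))}
    (hζ₀ : IsCMField.complexConj K ζ₀ = -ζ₀) (h0 : ζ₀ ≠ 0) (hT : CMTypeLattice.IsOfType 𝔪 ζ₀ 𝔣₀)
    (u : (𝓞 K)ˣ) (hu : IsCMField.complexConj K ((u : 𝓞 K) : K) = ((u : 𝓞 K) : K))
    (hsign : ∀ φ ∈ Φ.1, ((φ ((u : 𝓞 K) : K)).re < 0 ↔ (φ ζ₀).im < 0)) :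
    ∃ ζ : K, IsCMField.complexConj K ζ = -ζ ∧ (∀ φ : Φ.1, 0 < (φ.1 ζ).im) ∧ CMTypeLattice.IsOfType 𝔪 ζ 𝔣₀ := by
  refine (exists_pos_isOfType_iff_exists_units Φ 𝔪 hζ₀ h0 hT).mpr ⟨u, hu, fun φ => ?_⟩
  have hre := re_embedding_ne_zero_of_real hu (coe_units_ne_zero u) φ.1
  have him := im_embedding_ne_zero_of_skew hζ₀ h0 φ.1
  have hiff := hsign φ.1 φ.2
  rcases lt_or_gt_of_ne him with hlt | hgt
  · exact mul_pos_of_neg_of_neg (hiff.mpr hlt) hlt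
  · have hre' : 0 < (φ.1 ((u : 𝓞 K) : K)).re :=
      lt_of_le_of_ne (not_lt.mp fun h => (lt_asymm (hiff.mp h)) hgt) hre.symm
    exact mul_pos hre' hgt

open scoped Classical in
/-- **THE CENSUS'S TWISTED YES VERDICTS (kernel form, every level, every family).**  `K = ℚ(ζₙ)` a CM field,
`φ(n) = 2(k+1)`, a unit family with the family property and the same-class pair property on a symmetric class `C`.
If the CM type `Φ` has `|S_Φ ∩ N_odd ∩ C|` and `|(S_Φ ∩ N_odd) ∖ C|` BOTH EVEN (the twisted sign vector of
`ξ = ζ^{g−1}/Φₙ′(ζ)` on `Φ` lies in the units' signature group), then `ℂ^Φ/Φ(ℤ[ζₙ])` CARRIES an `ι`-compatible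
principal polarisation: `∃ ζ′`, `ζ′^ρ = −ζ′`, `Im φ(ζ′) > 0` on `Φ`, `CMTypeLattice.IsOfType 1 ζ′ ⊤`.
research route conditional on HC_CM; not a corollary; Q11.4-sentence-2 already refuted in dim ≥ 3. [cite: Shimura1998, §14.3 Prop. 5, p. 104] -/
theorem exists_principal_of_pairs_on [IsCMField K] [IsCyclotomicExtension {n} ℚ K] (hζ : IsPrimitiveRoot ζ n)
    {k : ℕ} (hg : Nat.totient n = 2 * (k + 1)) (hfam : FamilyProperty) (hpair : PairPropertyOn)
    (hC : ∀ t : ZMod n, t.val.Coprime n → (-t ∈ C ↔ t ∈ C)) (Φ : CMType K)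
    (hevC : Even (((Finset.univ.filter fun t : ZMod n => ∃ σ ∈ Φ.1, σ ζ = 𝐞 t) ∩ Nodd).filter
      fun t => t ∈ C).card)
    (hevC' : Even (((Finset.univ.filter fun t : ZMod n => ∃ σ ∈ Φ.1, σ ζ = 𝐞 t) ∩ Nodd).filter
      fun t => t ∉ C).card) :
    ∃ ζ' : K, IsCMField.complexConj K ζ' = -ζ' ∧ (∀ φ : Φ.1, 0 < (φ.1 ζ').im) ∧
        CMTypeLattice.IsOfType (1 : (FractionalIdeal (𝓞 K)⁰ K)ˣ) ζ' ⊤ := by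
  classical
  -- the residues read by the negative set of `ξ` on `Φ` are `S_Φ ∩ N_odd` ((F0), part 7)
  have hJ : ∀ t : ZMod n, t ∈ (Finset.univ.filter fun t : ZMod n => ∃ σ ∈ Φ.1, σ ζ = 𝐞 t) ∩ Nodd ↔
      ∃ σ ∈ (Φ.1 ∩ {ψ : K →+* ℂ | (ψ (ζ ^ k * (aeval ζ (derivative (cyclotomic n ℚ)))⁻¹)).im < 0}),
        σ ζ = 𝐞 t := by
    intro t
    simp only [Finset.mem_filter, Finset.mem_univ, true_and, Finset.mem_inter, Set.mem_inter_iff,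
      Set.mem_setOf_eq]
    constructor
    · rintro ⟨⟨σ, hσΦ, hσt⟩, -, heven⟩
      exact ⟨σ, ⟨hσΦ, (im_embedding_xi_neg_iff hζ hg hσt).mpr heven⟩, hσt⟩
    · rintro ⟨σ, ⟨hσΦ, hσneg⟩, hσt⟩
      have ht : t.val.Coprime n := coprime_of_apply_eq_toCircle hζ hσt
      exact ⟨⟨σ, hσΦ, hσt⟩, ht, (im_embedding_xi_neg_iff hζ hg hσt).mp hσneg⟩
  obtain ⟨u, hu, hsign⟩ := exists_units_sign_eq_on σ adm C hζ hfam hpair hC Φ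
    (Φ.1 ∩ {ψ : K →+* ℂ | (ψ (ζ ^ k * (aeval ζ (derivative (cyclotomic n ℚ)))⁻¹)).im < 0})
    Set.inter_subset_left _ hJ hevC hevC'
  refine exists_pos_isOfType_of_units_sign Φ 1 (complexConj_xi hζ hg) (xi_ne_zero hζ k)
    (isOfType_one_xi_top hζ k) u hu fun φ hφ => ?_
  rw [hsign φ hφ]
  simp only [Set.mem_inter_iff, Set.mem_setOf_eq]
  exact ⟨fun h => h.2, fun h => ⟨hφ, h⟩⟩

end Summit.HodgeConjecture.Ring2WeilCoverage.TwistedUnitWitnesses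

end
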